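import Summits.ResolutionOfSingularities.ResolutionOfSingularities.Theorems.FrobeniusClosingSteerEtaleTowerField
import Summits.ResolutionOfSingularities.ResolutionOfSingularities.Theorems.FrobeniusClosingSteerEtaleTowerResidue
import Summits.ResolutionOfSingularities.ResolutionOfSingularities.Theorems.FrobeniusClosingSteerEtaleResidueLiftSeparable
import Summits.ResolutionOfSingularities.ResolutionOfSingularities.Theorems.FrobeniusClosingSteerQuadraticTransformLevelLift
import Summits.ResolutionOfSingularities.ResolutionOfSingularities.Theorems.FrobeniusClosingSteerWindowBaseChange
import Summits.ResolutionOfSingularities.ResolutionOfSingularities.Theorems.FrobeniusClosingSteerGeomChartTwoBasis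
import Summits.ResolutionOfSingularities.ResolutionOfSingularities.Theorems.FrobeniusClosingSteerGeomChainAssemblyTwo
import Mathlib.RingTheory.AdicCompletion.LocalRing
import Mathlib.Algebra.CharP.Algebra
import HarnessLib

/-!
# [OURS · L0 W4.1] K3ᴳ (F5b): the HORIZON BASE CHANGE `horizonBaseChange_of_lengthComparison` — the `hK3G` binder of the hGW3 assembler
# (`GeomAssembly.geomChain_false_of_pieces_all`, p564413) CLOSED MODULO the ℓ-comparison lemma of res-L0-w41-stub-2's SPEC
# `L/res-L0-w41-stub-2/K3G/JacobianLengthEtale_signature.lean` (hand res-D-pv-028), stated as the named hypothesis `hℓ` verbatim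
# (chain W4.1 `FrobeniusClosingSteer`, crux stmt-ResolutionOfSingularities-16345; K3ᴳ target `L/res-L0-w41-stub-2/K3G/K3G_target_signature.lean`
# 8151858124874f54; `--supports … --as helper`)

HONEST FRAMING. OURS kernel (HIRONAKA-L librarian res-D-lib-1 gen 8). For a geometric chain `S` (every step residually rational or of residue degree 3)
and a horizon `M`: `…EtaleTowerResidue.exists_compat_root` (finite separable `κ(S (M+1))/κ(S 0)`, compatible `ψ`, monic separable `P`, root `θ`), the
étale tower `Tₘ := (S m[X]/(P))_𝔫ₘ` (`…EtaleTowerLevels`) read in `L′ := Frac (lim Tₘ)` (`…SeqDirectLimit`, `…EtaleTowerField`): `S′ m := range jₘ` with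
`EtaleLift.LevelLift` at every level, quadratic transforms / exceptional parameters upstairs (res-D-pv-040 `…QuadraticTransformLevelLift`), laws
(`EtaleLift.law_lift`), isolated germs (inside `LevelLift`, res-D-pv-040 K3-c), rationality below `M`, finite 2-bases of every `κ(S′ m)`
(`GeomTwoBasis.exists_twoBasis_residueField_of_chart` + `…EtaleResidueLiftSeparable` + `TwoBasis.isTwoBasis_algebraMap_of_isSeparable`), the dual 2-frame of
`κ(Ŝ′₀)` (`TwoBasis.exists_twoBasis_dual_derivations` + `exists_pFrame_of_isSeparable`), and the ℓ-comparison from `hℓ` at `S 0 → T 0 ≅ S′ 0`.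
* `horizonBaseChange_of_lengthComparison (hℓ) : <body of K3GTarget.horizonBaseChange>`; consumption check: with I″ it closes hGW3's body by
  `GeomAssembly.geomChain_false_of_pieces_all` (see the `example`).
Nothing here is a statement of H. Hironaka's manuscript [Hironaka2017]. AI-written; AI review is weaker than expert review. [folklore]
-/

set_option linter.dupNamespace false

noncomputable section

namespace Summit.ResolutionOfSingularities.ResolutionOfSingularities.Theorems.SwitchingDichotomy.EtaleTower

open IsLocalRing Polynomial Literature.AlgebraicGeometry.Resolution
open Summit.ResolutionOfSingularities.ResolutionOfSingularities.Theorems.SwitchingDichotomy.EtaleLift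
open Summit.ResolutionOfSingularities.ResolutionOfSingularities.Theorems.SwitchingDichotomy.QuadraticTransformLift
open Summit.ResolutionOfSingularities.ResolutionOfSingularities.Theorems.SwitchingDichotomy.SigmaTopLegality

/-! ## §1 The level maps `φ m : S m → S′ m := range jₘ` and the residue fields of the lifted chain (generic embeddings `jₘ`) -/

section Levels

variable {L : Type} [Field L] (S : ℕ → Subring L) [∀ m, IsLocalRing (S m)] (hdom : ∀ m, SubringDominates (S m) (S (m + 1)))
  (P : (S 0)[X]) {k' : Type} [Field k'] (ψ : ∀ m, ResidueField (S m) →+* k') (hψ : IsCompat S hdom ψ) (θ : k')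
  (hθ₀ : P.eval₂ ((ψ 0).comp (residue (S 0))) θ = 0)
  {L' : Type} [Field L'] (j : ∀ m, Localization.AtPrime (kerT S hdom P ψ hψ θ hθ₀ m) →+* L')
  (hjsucc : ∀ m, (j (m + 1)).comp (gT S hdom P ψ hψ θ hθ₀ m) = j m)

/-- **`φ m : S m → S′ m`**, `S′ m := range jₘ`. [invented: ours] -/
abbrev levelMap (m : ℕ) : S m →+* (j m).range := (j m).rangeRestrict.comp (algebraMap (S m) (Localization.AtPrime (kerT S hdom P ψ hψ θ hθ₀ m)))

/-- `Tₘ ≅ S′ m` (range of the injective `jₘ`). [invented: ours] -/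
abbrev levelEquiv (hj : ∀ m, Function.Injective (j m)) (m : ℕ) : Localization.AtPrime (kerT S hdom P ψ hψ θ hθ₀ m) ≃+* (j m).range :=
  RingEquiv.ofBijective (j m).rangeRestrict (bijective_rangeRestrict _ (hj m))

include hjsucc in
/-- `φ m` is a local homomorphism (a conjunct of `LevelLift`). [folklore] -/
theorem isLocalHom_levelMap (hreg : ∀ m, IsRegularLocalRing (S m)) (hP : P.Monic) (hsep : (P.map (residue (S 0))).Separable)
    (hj : ∀ m, Function.Injective (j m)) (m : ℕ) :
    haveI := isLocalRing_range (j m)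
    IsLocalHom (levelMap S hdom P ψ hψ θ hθ₀ j m) := by
  haveI := isLocalRing_range (j m)
  exact (levelLift_j S hdom P ψ hψ θ hθ₀ j hjsucc hreg hP hsep hj m).1

include hjsucc in
/-- **`κ(S′ m)/κ(S m)` is finite and separable** (transport of `…EtaleResidueLiftSeparable` along `Tₘ ≅ S′ m`). [folklore] -/
theorem finite_isSeparable_residueField_range (hreg : ∀ m, IsRegularLocalRing (S m)) (hP : P.Monic)
    (hsep : (P.map (residue (S 0))).Separable) (hj : ∀ m, Function.Injective (j m)) (m : ℕ) :
    haveI := isLocalRing_range (j m)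
    letI := (levelMap S hdom P ψ hψ θ hθ₀ j m).toAlgebra
    haveI : IsLocalHom (algebraMap (S m) (j m).range) := isLocalHom_levelMap S hdom P ψ hψ θ hθ₀ j hjsucc hreg hP hsep hj m
    Module.Finite (ResidueField (S m)) (ResidueField (j m).range) ∧ Algebra.IsSeparable (ResidueField (S m)) (ResidueField (j m).range) := by
  haveI := isLocalRing_range (j m)
  letI := (levelMap S hdom P ψ hψ θ hθ₀ j m).toAlgebra
  haveI : IsLocalHom (algebraMap (S m) (j m).range) := isLocalHom_levelMap S hdom P ψ hψ θ hθ₀ j hjsucc hreg hP hsep hj m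
  haveI := isMaximal_kerT S hdom P ψ hψ θ hθ₀ hP m
  haveI := isLocalHom_algebraMap_localization_ker_lift (Ptower S hdom P m) (ψ m) θ (eval₂_Ptower S hdom P ψ hψ θ hθ₀ m)
    (monic_Ptower S hdom P hP m)
  haveI hfin := finite_residueField_localization_ker_lift (Ptower S hdom P m) (ψ m) θ (eval₂_Ptower S hdom P ψ hψ θ hθ₀ m)
    (monic_Ptower S hdom P hP m)
  haveI hsep' := isSeparable_residueField_localization_ker_lift (Ptower S hdom P m) (ψ m) θ (eval₂_Ptower S hdom P ψ hψ θ hθ₀ m)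
    (monic_Ptower S hdom P hP m) (separable_Ptower S hdom P hsep m)
  -- transport along `κ(Tₘ) ≅ κ(S′ m)`
  let e₂ := ResidueField.mapEquiv (levelEquiv S hdom P ψ hψ θ hθ₀ j hj m)
  have he : (algebraMap (ResidueField (S m)) (ResidueField (j m).range)).comp (RingEquiv.refl (ResidueField (S m))).toRingHom =
      e₂.toRingHom.comp (algebraMap (ResidueField (S m)) (ResidueField (Localization.AtPrime (kerT S hdom P ψ hψ θ hθ₀ m)))) := by
    refine RingHom.ext fun z => ?_
    obtain ⟨s, rfl⟩ := residue_surjective z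
    change algebraMap (ResidueField (S m)) (ResidueField (j m).range) (residue (S m) s) =
      e₂ (algebraMap (ResidueField (S m)) (ResidueField (Localization.AtPrime (kerT S hdom P ψ hψ θ hθ₀ m))) (residue (S m) s))
    rw [IsLocalRing.ResidueField.algebraMap_residue, IsLocalRing.ResidueField.algebraMap_residue, ResidueField.mapEquiv_apply,
      ResidueField.map_residue]
    rfl
  exact ⟨Module.Finite.of_equiv_equiv (RingEquiv.refl _) e₂ he, Algebra.IsSeparable.of_equiv_equiv (RingEquiv.refl _) e₂ he⟩

include hjsucc in
/-- **A finite 2-basis of `κ(S′ m)`** from a geometric chart of `S m` (perfect ground field `k`). [cite: Matsumura1987, Thm. 26.5] -/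
theorem exists_twoBasis_residueField_range (hreg : ∀ m, IsRegularLocalRing (S m)) (hP : P.Monic)
    (hsep : (P.map (residue (S 0))).Separable) (hj : ∀ m, Function.Injective (j m))
    (k : Type) [Field k] [PerfectField k] [CharP L 2] [Algebra k L] (m : ℕ) (A : Subalgebra k L) (Q : Ideal A)
    (hA : A.FG) (hQ : Q.IsPrime) (hS : ∀ z : L, z ∈ S m ↔ ∃ a b : A, b ∉ Q ∧ z = (a : L) / (b : L)) :
    haveI := isLocalRing_range (j m)
    ∃ (r : ℕ) (b : Fin r → ResidueField (j m).range), TwoBasis.IsTwoBasis b := by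
  haveI := isLocalRing_range (j m)
  haveI : Fact (Nat.Prime 2) := ⟨Nat.prime_two⟩
  obtain ⟨r, b, hb⟩ := GeomTwoBasis.exists_twoBasis_residueField_of_chart k L A Q (S m) hA hQ hS
  letI := (levelMap S hdom P ψ hψ θ hθ₀ j m).toAlgebra
  haveI : IsLocalHom (algebraMap (S m) (j m).range) := isLocalHom_levelMap S hdom P ψ hψ θ hθ₀ j hjsucc hreg hP hsep hj m
  obtain ⟨hfin, hsep'⟩ := finite_isSeparable_residueField_range S hdom P ψ hψ θ hθ₀ j hjsucc hreg hP hsep hj m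
  haveI := hfin; haveI := hsep'
  haveI : CharP (ResidueField (S m)) 2 := RadicandCohenFrame.charP_residueField 2
  exact ⟨r, _, TwoBasis.isTwoBasis_algebraMap_of_isSeparable (ResidueField (S m)) (ResidueField (j m).range) b hb⟩

set_option maxHeartbeats 1600000 in
include hjsucc in
/-- **A finite 2-basis with dual `ℤ`-derivations of `κ(Ŝ′₀)`** from a geometric chart of `S 0` (perfect ground field `k`): the frame of `κ(Q)`
(`TwoBasis.exists_twoBasis_dual_derivations`) transported to the finite separable `κ(Ŝ′₀) = κ(S′₀) ⊇ κ(S 0) ≅ κ(Q)` (`TwoBasis.exists_pFrame_of_isSeparable`).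
[cite: Matsumura1987, §26 Thm. 26.7] -/
theorem exists_pFrame_completion_range (hreg : ∀ m, IsRegularLocalRing (S m)) (hP : P.Monic)
    (hsep : (P.map (residue (S 0))).Separable) (hj : ∀ m, Function.Injective (j m))
    (k : Type) [Field k] [PerfectField k] [CharP L 2] [CharP L' 2] [Algebra k L] (A : Subalgebra k L) (Q : Ideal A)
    (hA : A.FG) (hQ : Q.IsPrime) (hS : ∀ z : L, z ∈ S 0 ↔ ∃ a b : A, b ∉ Q ∧ z = (a : L) / (b : L)) :
    haveI := isLocalRing_range (j 0)
    ∃ (r : ℕ) (γ : Fin r → ResidueField (AdicCompletion (maximalIdeal (j 0).range) (j 0).range))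
      (D : Fin r → Derivation ℤ (ResidueField (AdicCompletion (maximalIdeal (j 0).range) (j 0).range))
        (ResidueField (AdicCompletion (maximalIdeal (j 0).range) (j 0).range))),
      TwoBasis.IsTwoBasis γ ∧ ∀ l l', D l (γ l') = if l' = l then 1 else 0 := by
  haveI := isLocalRing_range (j 0)
  haveI : Fact (Nat.Prime 2) := ⟨Nat.prime_two⟩
  haveI : IsRegularLocalRing (S 0) := hreg 0
  haveI hreg' : IsRegularLocalRing (j 0).range := (levelLift_j S hdom P ψ hψ θ hθ₀ j hjsucc hreg hP hsep hj 0).2.2.2.2.2.1 (hreg 0)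
  haveI := hQ
  haveI : CharP k 2 := (algebraMap k L).charP (algebraMap k L).injective 2
  haveI : Algebra.FiniteType k A := (Subalgebra.fg_iff_finiteType A).mp hA
  haveI : Algebra.EssFiniteType k Q.ResidueField := Algebra.EssFiniteType.comp k A _
  have hfg : (⊤ : IntermediateField k Q.ResidueField).FG := IntermediateField.fg_top_iff.mpr inferInstance
  obtain ⟨r, lam, D, hB, hD⟩ := TwoBasis.exists_twoBasis_dual_derivations k Q.ResidueField hfg
  obtain ⟨e⟩ := GeomChain.nonempty_residueField_ringEquiv A Q (S 0) hS
  -- the residue field of `S′ 0` over `κ(S 0)`, and of its completion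
  letI := (levelMap S hdom P ψ hψ θ hθ₀ j 0).toAlgebra
  haveI : IsLocalHom (algebraMap (S 0) (j 0).range) := isLocalHom_levelMap S hdom P ψ hψ θ hθ₀ j hjsucc hreg hP hsep hj 0
  obtain ⟨hfin, hsep'⟩ := finite_isSeparable_residueField_range S hdom P ψ hψ θ hθ₀ j hjsucc hreg hP hsep hj 0
  haveI := hfin; haveI := hsep'
  let e₁ : ResidueField (j 0).range ≃+* ResidueField (AdicCompletion (maximalIdeal (j 0).range) (j 0).range) :=
    RingEquiv.ofBijective _ (AdicCompletion.residueField_map_bijective (j 0).range)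
  -- `κ(Q) → κ(Ŝ′₀)` as an algebra, finite separable by transport from `κ(S 0) → κ(S′ 0)`
  let ρ : Q.ResidueField →+* ResidueField (AdicCompletion (maximalIdeal (j 0).range) (j 0).range) :=
    (e₁.toRingHom.comp (algebraMap (ResidueField (S 0)) (ResidueField (j 0).range))).comp e.symm.toRingHom
  letI algρ : Algebra Q.ResidueField (ResidueField (AdicCompletion (maximalIdeal (j 0).range) (j 0).range)) := ρ.toAlgebra
  letI algk : Algebra k (ResidueField (AdicCompletion (maximalIdeal (j 0).range) (j 0).range)) :=
    (ρ.comp (algebraMap k Q.ResidueField)).toAlgebra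
  haveI : IsScalarTower k Q.ResidueField (ResidueField (AdicCompletion (maximalIdeal (j 0).range) (j 0).range)) :=
    IsScalarTower.of_algebraMap_eq fun _ => rfl
  have he : (algebraMap Q.ResidueField (ResidueField (AdicCompletion (maximalIdeal (j 0).range) (j 0).range))).comp e.toRingHom =
      e₁.toRingHom.comp (algebraMap (ResidueField (S 0)) (ResidueField (j 0).range)) := by
    refine RingHom.ext fun z => ?_
    change e₁ (algebraMap (ResidueField (S 0)) (ResidueField (j 0).range) (e.symm (e z))) =
      e₁ (algebraMap (ResidueField (S 0)) (ResidueField (j 0).range) z)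
    rw [RingEquiv.symm_apply_apply]
  haveI := Module.Finite.of_equiv_equiv e e₁ he
  haveI := Algebra.IsSeparable.of_equiv_equiv e e₁ he
  haveI : CharP (AdicCompletion (maximalIdeal (j 0).range) (j 0).range) 2 := RadicandCohenFrame.charP_adicCompletion 2 (j 0).range
  haveI : CharP (ResidueField (AdicCompletion (maximalIdeal (j 0).range) (j 0).range)) 2 := RadicandCohenFrame.charP_residueField 2
  obtain ⟨D', hB1, hdual, -, -⟩ := TwoBasis.exists_pFrame_of_isSeparable k Q.ResidueField
    (ResidueField (AdicCompletion (maximalIdeal (j 0).range) (j 0).range)) lam hB D hD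
  exact ⟨r, _, D', hB1, hdual⟩

/-- **The étale presentation of `S′ 0`**: `S′ 0 ≅ T₀ = (S 0[X]/(P))_𝔫₀` is the localisation at `𝔫₀` of the finite étale `S 0`-algebra `S 0[X]/(P)` —
packaged as the ℓ-comparison clause, given the abstract ℓ-comparison lemma `hℓ` (res-L0-w41-stub-2's SPEC, hand res-D-pv-028). [cite: StacksProject, Tag 00UW] -/
theorem length_le_range_of_lengthComparison
    (hℓ : ∀ {S A S' : Type} [CommRing S] [CommRing A] [CommRing S'] [IsLocalRing S] [IsNoetherianRing S] [IsLocalRing S']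
      [IsNoetherianRing S'] [Algebra S A] [Algebra.Etale S A] [Module.Finite S A] (𝔫 : Ideal A) [𝔫.IsPrime]
      [Algebra A S'] [IsLocalization.AtPrime S' 𝔫] [Algebra S S'] [IsScalarTower S A S'],
      𝔫.comap (algebraMap S A) = maximalIdeal S → ∀ f : S,
      Module.length (AdicCompletion (maximalIdeal S') S') (AdicCompletion (maximalIdeal S') S' ⧸
          Ideal.span (Set.range fun Dv : Derivation ℤ (AdicCompletion (maximalIdeal S') S') (AdicCompletion (maximalIdeal S') S') =>
            Dv (algebraMap S' (AdicCompletion (maximalIdeal S') S') (algebraMap S S' f)))) ≤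
        Module.length (AdicCompletion (maximalIdeal S) S) (AdicCompletion (maximalIdeal S) S ⧸
          Ideal.span (Set.range fun Dv : Derivation ℤ (AdicCompletion (maximalIdeal S) S) (AdicCompletion (maximalIdeal S) S) =>
            Dv (algebraMap S (AdicCompletion (maximalIdeal S) S) f))))
    (hP : P.Monic) (hsep : (P.map (residue (S 0))).Separable) (hj : ∀ m, Function.Injective (j m)) [IsNoetherianRing (S 0)] (f₀ : S 0) :
    haveI := isLocalRing_range (j 0)
    ∀ [IsNoetherianRing (j 0).range],
    Module.length (AdicCompletion (maximalIdeal (j 0).range) (j 0).range) (AdicCompletion (maximalIdeal (j 0).range) (j 0).range ⧸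
      Ideal.span (Set.range fun Dv : Derivation ℤ (AdicCompletion (maximalIdeal (j 0).range) (j 0).range)
        (AdicCompletion (maximalIdeal (j 0).range) (j 0).range) =>
        Dv (algebraMap (j 0).range (AdicCompletion (maximalIdeal (j 0).range) (j 0).range) (levelMap S hdom P ψ hψ θ hθ₀ j 0 f₀)))) ≤
      Module.length (AdicCompletion (maximalIdeal (S 0)) (S 0)) (AdicCompletion (maximalIdeal (S 0)) (S 0) ⧸
        Ideal.span (Set.range fun Dv : Derivation ℤ (AdicCompletion (maximalIdeal (S 0)) (S 0)) (AdicCompletion (maximalIdeal (S 0)) (S 0)) =>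
          Dv (algebraMap (S 0) (AdicCompletion (maximalIdeal (S 0)) (S 0)) f₀))) := by
  haveI := isLocalRing_range (j 0)
  intro _
  haveI : Algebra.Etale (S 0) (AdjoinRoot (Ptower S hdom P 0)) := etale_adjoinRoot (S := S 0) P hP hsep
  haveI : Module.Finite (S 0) (AdjoinRoot (Ptower S hdom P 0)) := hP.finite_adjoinRoot
  letI algA : Algebra (AdjoinRoot (Ptower S hdom P 0)) (j 0).range :=
    ((levelEquiv S hdom P ψ hψ θ hθ₀ j hj 0).toRingHom.comp (algebraMap (AdjoinRoot (Ptower S hdom P 0)) _)).toAlgebra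
  letI algS : Algebra (S 0) (j 0).range := (levelMap S hdom P ψ hψ θ hθ₀ j 0).toAlgebra
  haveI : IsScalarTower (S 0) (AdjoinRoot (Ptower S hdom P 0)) (j 0).range :=
    IsScalarTower.of_algebraMap_eq fun s => by
      change (j 0).rangeRestrict (algebraMap (S 0) _ s) =
        (j 0).rangeRestrict (algebraMap (AdjoinRoot (Ptower S hdom P 0)) _ (algebraMap (S 0) _ s))
      rw [← IsScalarTower.algebraMap_apply]
  let eA : Localization.AtPrime (kerT S hdom P ψ hψ θ hθ₀ 0) ≃ₐ[AdjoinRoot (Ptower S hdom P 0)] (j 0).range :=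
    AlgEquiv.ofRingEquiv (f := levelEquiv S hdom P ψ hψ θ hθ₀ j hj 0) fun _ => rfl
  haveI : IsLocalization.AtPrime (j 0).range (kerT S hdom P ψ hψ θ hθ₀ 0) :=
    IsLocalization.isLocalization_of_algEquiv (kerT S hdom P ψ hψ θ hθ₀ 0).primeCompl eA
  have h𝔫 : (kerT S hdom P ψ hψ θ hθ₀ 0).comap (algebraMap (S 0) (AdjoinRoot (Ptower S hdom P 0))) = maximalIdeal (S 0) :=
    comap_ker_lift P (ψ 0) θ hθ₀
  exact hℓ (S := S 0) (A := AdjoinRoot (Ptower S hdom P 0)) (S' := (j 0).range) (kerT S hdom P ψ hψ θ hθ₀ 0) h𝔫 f₀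

end Levels

/-! ## §2 The horizon base change through a compatible family of embeddings -/

section Generic

variable {L : Type} [Field L] [CharP L 2] (S : ℕ → Subring L) [∀ m, IsLocalRing (S m)] (hdom : ∀ m, SubringDominates (S m) (S (m + 1)))
  (P : (S 0)[X]) {k' : Type} [Field k'] (ψ : ∀ m, ResidueField (S m) →+* k') (hψ : IsCompat S hdom ψ) (θ : k')
  (hθ₀ : P.eval₂ ((ψ 0).comp (residue (S 0))) θ = 0)
  {L' : Type} [Field L'] (j : ∀ m, Localization.AtPrime (kerT S hdom P ψ hψ θ hθ₀ m) →+* L')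
  (hjsucc : ∀ m, (j (m + 1)).comp (gT S hdom P ψ hψ θ hθ₀ m) = j m)

include hjsucc in
/-- **The horizon base change read through embeddings `jₘ : Tₘ → L′`** (compatible, injective): all clauses of the K3ᴳ continuation for the chain
`S′ m := range jₘ`, modulo the ℓ-comparison `hℓ`. [cite: StacksProject, Tag 00TV] -/
theorem horizon_cont_of_embeddings
    (hℓ : ∀ {S A S' : Type} [CommRing S] [CommRing A] [CommRing S'] [IsLocalRing S] [IsNoetherianRing S] [IsLocalRing S']
      [IsNoetherianRing S'] [Algebra S A] [Algebra.Etale S A] [Module.Finite S A] (𝔫 : Ideal A) [𝔫.IsPrime]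
      [Algebra A S'] [IsLocalization.AtPrime S' 𝔫] [Algebra S S'] [IsScalarTower S A S'],
      𝔫.comap (algebraMap S A) = maximalIdeal S → ∀ f : S,
      Module.length (AdicCompletion (maximalIdeal S') S') (AdicCompletion (maximalIdeal S') S' ⧸
          Ideal.span (Set.range fun Dv : Derivation ℤ (AdicCompletion (maximalIdeal S') S') (AdicCompletion (maximalIdeal S') S') =>
            Dv (algebraMap S' (AdicCompletion (maximalIdeal S') S') (algebraMap S S' f)))) ≤
        Module.length (AdicCompletion (maximalIdeal S) S) (AdicCompletion (maximalIdeal S) S ⧸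
          Ideal.span (Set.range fun Dv : Derivation ℤ (AdicCompletion (maximalIdeal S) S) (AdicCompletion (maximalIdeal S) S) =>
            Dv (algebraMap S (AdicCompletion (maximalIdeal S) S) f))))
    (k : Type) [Field k] [PerfectField k] [Algebra k L] (hle : ∀ m, S m ≤ S (m + 1)) (f g : ∀ m, S m) (x : ∀ m, S (m + 1))
    (hgeom : ∀ m, ∃ (A : Subalgebra k L) (Q : Ideal A), A.FG ∧ Q.IsPrime ∧ (∃ Q' : Ideal A, Q'.IsPrime ∧ Q < Q') ∧
      ∀ z : L, z ∈ S m ↔ ∃ a b : A, b ∉ Q ∧ z = (a : L) / (b : L))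
    (hreg : ∀ m, IsRegularLocalRing (S m)) (hexc : ∀ m, IsExcellentRing (S m)) (hdim : ∀ m, ringKrullDim (S m) = (3 : ℕ))
    (hqt : ∀ m, IsQuadraticTransform (S m) (S (m + 1)))
    (hx : ∀ m, Ideal.span ((fun y : S m => (⟨(y : L), hle m y.2⟩ : S (m + 1))) '' (maximalIdeal (S m) : Set (S m))) = Ideal.span {x m})
    (hlaw : ∀ m, ((f (m + 1) : S (m + 1)) : L) * ((x m : S (m + 1)) : L) ^ (2 * 2) = ((f m : S m) : L) - ((g m : S m) : L) ^ 2)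
    (hiso : ∀ m, HasIsolatedSingularity (RadicandRing (S m) 2 (f m)))
    (hP : P.Monic) (hsep : (P.map (residue (S 0))).Separable) (hj : ∀ m, Function.Injective (j m)) (M : ℕ)
    (hcoeff : ∀ m, m < M → ∀ c : S (m + 1), ∃ q : (S 0)[X], ψ (m + 1) (residue (S (m + 1)) c) = q.eval₂ ((ψ 0).comp (residue (S 0))) θ)
    (C : Prop)
    (cont : (∀ (L' : Type) [Field L'] [CharP L' 2] (S' : ℕ → Subring L') [∀ m, IsLocalRing (S' m)] [∀ m, IsNoetherianRing (S' m)]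
          (hle' : ∀ m, S' m ≤ S' (m + 1)) (f' g' : ∀ m, S' m) (x' : ∀ m, S' (m + 1)),
          (∀ m, IsRegularLocalRing (S' m)) → (∀ m, IsExcellentRing (S' m)) → (∀ m, ringKrullDim (S' m) = (3 : ℕ)) →
          (∀ m, IsQuadraticTransform (S' m) (S' (m + 1))) →
          (∀ m, Ideal.span ((fun y : S' m => (⟨(y : L'), hle' m y.2⟩ : S' (m + 1))) '' (maximalIdeal (S' m) : Set (S' m)))
              = Ideal.span {x' m}) →
          (∀ m, ((f' (m + 1) : S' (m + 1)) : L') * ((x' m : S' (m + 1)) : L') ^ (2 * 2) =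
              ((f' m : S' m) : L') - ((g' m : S' m) : L') ^ 2) →
          (∀ m, HasIsolatedSingularity (RadicandRing (S' m) 2 (f' m))) →
          (∀ m, m < M → ∀ z : S' (m + 1), ∃ s : S' m, z - ⟨(s : L'), hle' m s.2⟩ ∈ maximalIdeal (S' (m + 1))) →
          (∀ m, ∃ (r : ℕ) (b : Fin r → ResidueField (S' m)), TwoBasis.IsTwoBasis b) →
          (∃ (r : ℕ) (γ : Fin r → ResidueField (AdicCompletion (maximalIdeal (S' 0)) (S' 0)))
            (D : Fin r → Derivation ℤ (ResidueField (AdicCompletion (maximalIdeal (S' 0)) (S' 0)))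
              (ResidueField (AdicCompletion (maximalIdeal (S' 0)) (S' 0)))),
            TwoBasis.IsTwoBasis γ ∧ ∀ l l', D l (γ l') = if l' = l then 1 else 0) →
          Module.length (AdicCompletion (maximalIdeal (S' 0)) (S' 0)) (AdicCompletion (maximalIdeal (S' 0)) (S' 0) ⧸
              Ideal.span (Set.range fun Dv : Derivation ℤ (AdicCompletion (maximalIdeal (S' 0)) (S' 0)) (AdicCompletion (maximalIdeal (S' 0)) (S' 0)) =>
                Dv (algebraMap (S' 0) (AdicCompletion (maximalIdeal (S' 0)) (S' 0)) (f' 0)))) ≤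
            Module.length (AdicCompletion (maximalIdeal (S 0)) (S 0)) (AdicCompletion (maximalIdeal (S 0)) (S 0) ⧸
              Ideal.span (Set.range fun Dv : Derivation ℤ (AdicCompletion (maximalIdeal (S 0)) (S 0)) (AdicCompletion (maximalIdeal (S 0)) (S 0)) =>
                Dv (algebraMap (S 0) (AdicCompletion (maximalIdeal (S 0)) (S 0)) (f 0)))) →
          C)) : C := by
  classical
  haveI : Fact (Nat.Prime 2) := ⟨Nat.prime_two⟩
  haveI : ∀ m, IsRegularLocalRing (S m) := hreg
  haveI hl : ∀ m, IsLocalRing (j m).range := fun m => isLocalRing_range _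
  have hL := fun m => levelLift_j S hdom P ψ hψ θ hθ₀ j hjsucc hreg hP hsep hj m
  have hle' : ∀ m, (j m).range ≤ (j (m + 1)).range := range_j_le S hdom P ψ hψ θ hθ₀ j hjsucc
  have hdom' : ∀ m, SubringDominates (j m).range (j (m + 1)).range := dominates_range_j S hdom P ψ hψ θ hθ₀ j hjsucc hj
  have hsq : ∀ m (s : S m), ((levelMap S hdom P ψ hψ θ hθ₀ j (m + 1) (Subring.inclusion (hdom m).1 s) : (j (m + 1)).range) : L') =
      ((levelMap S hdom P ψ hψ θ hθ₀ j m s : (j m).range) : L') :=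
    fun m s => j_algebraMap_inclusion S hdom P ψ hψ θ hθ₀ j hjsucc m s
  haveI hreg' : ∀ m, IsRegularLocalRing (j m).range := fun m => (hL m).2.2.2.2.2.1 (hreg m)
  haveI : ∀ m, IsNoetherianRing (j m).range := fun m => inferInstance
  -- `char L′ = 2`
  haveI : CharP L' 2 :=
    charP_of_injective_ringHom (f := (j 0).range.subtype.comp (levelMap S hdom P ψ hψ θ hθ₀ j 0))
      (Subtype.val_injective.comp (injective_of_levelLift (hL 0))) 2
  -- ### the data upstairs
  let f' : ∀ m, (j m).range := fun m => levelMap S hdom P ψ hψ θ hθ₀ j m (f m)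
  let g' : ∀ m, (j m).range := fun m => levelMap S hdom P ψ hψ θ hθ₀ j m (g m)
  let x' : ∀ m, (j (m + 1)).range := fun m => levelMap S hdom P ψ hψ θ hθ₀ j (m + 1) (x m)
  have hexc' : ∀ m, IsExcellentRing (j m).range := fun m => (hL m).2.2.2.2.2.2.2.1 (hexc m)
  have hdim' : ∀ m, ringKrullDim (j m).range = (3 : ℕ) := fun m => (hL m).2.2.2.2.2.2.1.trans (hdim m)
  have hqt' : ∀ m, IsQuadraticTransform (j m).range (j (m + 1)).range := fun m =>
    isQuadraticTransform_of_levelLift (hqt m) (hle m) (hle' m) (hL m) (hL (m + 1)) (hsq m) (hdom' m)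
  have hx' : ∀ m, Ideal.span ((fun y : (j m).range => (⟨(y : L'), hle' m y.2⟩ : (j (m + 1)).range)) ''
      (maximalIdeal (j m).range : Set (j m).range)) = Ideal.span {x' m} := fun m =>
    span_image_maximalIdeal_of_levelLift (hle m) (hle' m) (levelMap S hdom P ψ hψ θ hθ₀ j (m + 1)) (hL m) (hsq m) (x m) (hx m)
  have hlaw' : ∀ m, ((f' (m + 1) : (j (m + 1)).range) : L') * ((x' m : (j (m + 1)).range) : L') ^ (2 * 2) =
      ((f' m : (j m).range) : L') - ((g' m : (j m).range) : L') ^ 2 := fun m =>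
    law_lift (hle m) (levelMap S hdom P ψ hψ θ hθ₀ j m) (levelMap S hdom P ψ hψ θ hθ₀ j (m + 1)) (hsq m) (f m) (g m) (f (m + 1)) (x m) (2 * 2) (hlaw m)
  have hiso' : ∀ m, HasIsolatedSingularity (RadicandRing (j m).range 2 (f' m)) := fun m => (hL m).2.2.2.2.2.2.2.2.2 (f m) (hiso m)
  have hrat' : ∀ m, m < M → ∀ z : (j (m + 1)).range, ∃ s : (j m).range,
      z - ⟨(s : L'), hle' m s.2⟩ ∈ maximalIdeal (j (m + 1)).range :=
    fun m hm => isResiduallyRational_range_j S hdom P ψ hψ θ hθ₀ j hjsucc hP hj m (hcoeff m hm)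
  -- ### finite 2-bases upstairs, the dual 2-frame of `κ(Ŝ′₀)`, the ℓ-comparison
  have hB' : ∀ m, ∃ (r : ℕ) (b : Fin r → ResidueField (j m).range), TwoBasis.IsTwoBasis b := fun m => by
    obtain ⟨A, Q, hA, hQ, -, hS⟩ := hgeom m
    exact exists_twoBasis_residueField_range S hdom P ψ hψ θ hθ₀ j hjsucc hreg hP hsep hj k m A Q hA hQ hS
  have hBhat' : ∃ (r : ℕ) (γ : Fin r → ResidueField (AdicCompletion (maximalIdeal (j 0).range) (j 0).range))
      (D : Fin r → Derivation ℤ (ResidueField (AdicCompletion (maximalIdeal (j 0).range) (j 0).range))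
        (ResidueField (AdicCompletion (maximalIdeal (j 0).range) (j 0).range))),
      TwoBasis.IsTwoBasis γ ∧ ∀ l l', D l (γ l') = if l' = l then 1 else 0 := by
    obtain ⟨A, Q, hA, hQ, -, hS⟩ := hgeom 0
    exact exists_pFrame_completion_range S hdom P ψ hψ θ hθ₀ j hjsucc hreg hP hsep hj k A Q hA hQ hS
  have hcmp := length_le_range_of_lengthComparison S hdom P ψ hψ θ hθ₀ j hℓ hP hsep hj (f 0)
  exact cont L' (fun m => (j m).range) hle' f' g' x' hreg' hexc' hdim' hqt' hx' hlaw' hiso' hrat' hB' hBhat' hcmp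

end Generic

/-! ## §3 The horizon base change -/



/-- **K3ᴳ — the HORIZON BASE CHANGE for the geometric chain at `d = 4`**, CLOSED MODULO the ℓ-comparison lemma `hℓ` (res-L0-w41-stub-2's SPEC
`K3GSpec.length_quotient_span_derivation_le_of_etale_localization`, hand res-D-pv-028; its statement is the binder verbatim). The conclusion is the body
of `K3GTarget.horizonBaseChange` = the `hK3G` binder of `GeomAssembly.geomChain_false_two_of_pieces` / `geomChain_false_of_pieces_all`.
[cite: StacksProject, Tag 00TV] -/
theorem horizonBaseChange_of_lengthComparison
    (hℓ : ∀ {S A S' : Type} [CommRing S] [CommRing A] [CommRing S'] [IsLocalRing S] [IsNoetherianRing S] [IsLocalRing S']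
      [IsNoetherianRing S'] [Algebra S A] [Algebra.Etale S A] [Module.Finite S A] (𝔫 : Ideal A) [𝔫.IsPrime]
      [Algebra A S'] [IsLocalization.AtPrime S' 𝔫] [Algebra S S'] [IsScalarTower S A S'],
      𝔫.comap (algebraMap S A) = maximalIdeal S → ∀ f : S,
      Module.length (AdicCompletion (maximalIdeal S') S') (AdicCompletion (maximalIdeal S') S' ⧸
          Ideal.span (Set.range fun Dv : Derivation ℤ (AdicCompletion (maximalIdeal S') S') (AdicCompletion (maximalIdeal S') S') =>
            Dv (algebraMap S' (AdicCompletion (maximalIdeal S') S') (algebraMap S S' f)))) ≤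
        Module.length (AdicCompletion (maximalIdeal S) S) (AdicCompletion (maximalIdeal S) S ⧸
          Ideal.span (Set.range fun Dv : Derivation ℤ (AdicCompletion (maximalIdeal S) S) (AdicCompletion (maximalIdeal S) S) =>
            Dv (algebraMap S (AdicCompletion (maximalIdeal S) S) f)))) :
    ∀ (k L : Type) [Field k] [PerfectField k] [Field L] [CharP L 2] [Algebra k L]
      (S : ℕ → Subring L) [∀ m, IsLocalRing (S m)]
      (hle : ∀ m, S m ≤ S (m + 1)) (f g : ∀ m, S m) (x : ∀ m, S (m + 1)),
      (∀ m, ∃ (A : Subalgebra k L) (Q : Ideal A), A.FG ∧ Q.IsPrime ∧ (∃ Q' : Ideal A, Q'.IsPrime ∧ Q < Q') ∧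
        ∀ z : L, z ∈ S m ↔ ∃ a b : A, b ∉ Q ∧ z = (a : L) / (b : L)) →
      (∀ m, IsRegularLocalRing (S m)) → (∀ m, IsExcellentRing (S m)) → (∀ m, ringKrullDim (S m) = (3 : ℕ)) →
      (∀ m, IsQuadraticTransform (S m) (S (m + 1))) →
      (∀ m, Ideal.span ((fun y : S m => (⟨(y : L), hle m y.2⟩ : S (m + 1))) '' (maximalIdeal (S m) : Set (S m)))
          = Ideal.span {x m}) →
      (∀ m, ((f (m + 1) : S (m + 1)) : L) * ((x m : S (m + 1)) : L) ^ (2 * 2) =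
          ((f m : S m) : L) - ((g m : S m) : L) ^ 2) →
      (∀ m, HasIsolatedSingularity (RadicandRing (S m) 2 (f m))) →
      (∀ m, (∀ z : S (m + 1), ∃ s : S m, z - ⟨(s : L), hle m s.2⟩ ∈ maximalIdeal (S (m + 1))) ∨
        ∃ u : Fin 3 → S (m + 1),
          (∀ a : Fin 3 → S m, (∑ i, (⟨((a i : S m) : L), hle m (a i).2⟩ : S (m + 1)) * u i) ∈ maximalIdeal (S (m + 1)) →
            ∀ i, a i ∈ maximalIdeal (S m)) ∧
          (∀ z : S (m + 1), ∃ a : Fin 3 → S m, z - ∑ i, (⟨((a i : S m) : L), hle m (a i).2⟩ : S (m + 1)) * u i ∈ maximalIdeal (S (m + 1)))) →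
      ∀ (M : ℕ) (C : Prop),
        (∀ (L' : Type) [Field L'] [CharP L' 2] (S' : ℕ → Subring L') [∀ m, IsLocalRing (S' m)] [∀ m, IsNoetherianRing (S' m)]
          (hle' : ∀ m, S' m ≤ S' (m + 1)) (f' g' : ∀ m, S' m) (x' : ∀ m, S' (m + 1)),
          (∀ m, IsRegularLocalRing (S' m)) → (∀ m, IsExcellentRing (S' m)) → (∀ m, ringKrullDim (S' m) = (3 : ℕ)) →
          (∀ m, IsQuadraticTransform (S' m) (S' (m + 1))) →
          (∀ m, Ideal.span ((fun y : S' m => (⟨(y : L'), hle' m y.2⟩ : S' (m + 1))) '' (maximalIdeal (S' m) : Set (S' m)))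
              = Ideal.span {x' m}) →
          (∀ m, ((f' (m + 1) : S' (m + 1)) : L') * ((x' m : S' (m + 1)) : L') ^ (2 * 2) =
              ((f' m : S' m) : L') - ((g' m : S' m) : L') ^ 2) →
          (∀ m, HasIsolatedSingularity (RadicandRing (S' m) 2 (f' m))) →
          (∀ m, m < M → ∀ z : S' (m + 1), ∃ s : S' m, z - ⟨(s : L'), hle' m s.2⟩ ∈ maximalIdeal (S' (m + 1))) →
          (∀ m, ∃ (r : ℕ) (b : Fin r → ResidueField (S' m)), TwoBasis.IsTwoBasis b) →
          (∃ (r : ℕ) (γ : Fin r → ResidueField (AdicCompletion (maximalIdeal (S' 0)) (S' 0)))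
            (D : Fin r → Derivation ℤ (ResidueField (AdicCompletion (maximalIdeal (S' 0)) (S' 0)))
              (ResidueField (AdicCompletion (maximalIdeal (S' 0)) (S' 0)))),
            TwoBasis.IsTwoBasis γ ∧ ∀ l l', D l (γ l') = if l' = l then 1 else 0) →
          Module.length (AdicCompletion (maximalIdeal (S' 0)) (S' 0)) (AdicCompletion (maximalIdeal (S' 0)) (S' 0) ⧸
              Ideal.span (Set.range fun Dv : Derivation ℤ (AdicCompletion (maximalIdeal (S' 0)) (S' 0)) (AdicCompletion (maximalIdeal (S' 0)) (S' 0)) =>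
                Dv (algebraMap (S' 0) (AdicCompletion (maximalIdeal (S' 0)) (S' 0)) (f' 0)))) ≤
            Module.length (AdicCompletion (maximalIdeal (S 0)) (S 0)) (AdicCompletion (maximalIdeal (S 0)) (S 0) ⧸
              Ideal.span (Set.range fun Dv : Derivation ℤ (AdicCompletion (maximalIdeal (S 0)) (S 0)) (AdicCompletion (maximalIdeal (S 0)) (S 0)) =>
                Dv (algebraMap (S 0) (AdicCompletion (maximalIdeal (S 0)) (S 0)) (f 0)))) →
          C) → C := by
  intro k L _ _ _ _ _ S _ hle f g x hgeom hreg hexc hdim hqt hx hlaw hiso hstep M C cont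
  have hdom : ∀ m, SubringDominates (S m) (S (m + 1)) := fun m => (hqt m).dominates
  obtain ⟨k', _instk', ψ, hψ, P, θ, hP, hsep, hθ₀, hcoeff⟩ := exists_compat_root S hle hdom hstep M
  haveI := isDomain_LimT S hdom P ψ hψ θ hθ₀ hreg hP hsep
  exact horizon_cont_of_embeddings S hdom P ψ hψ θ hθ₀ (jT S hdom P ψ hψ θ hθ₀) (jT_comp_gT S hdom P ψ hψ θ hθ₀) hℓ k hle f g x hgeom
    hreg hexc hdim hqt hx hlaw hiso hP hsep (injective_jT S hdom P ψ hψ θ hθ₀ hreg hP hsep) M hcoeff C cont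

end Summit.ResolutionOfSingularities.ResolutionOfSingularities.Theorems.SwitchingDichotomy.EtaleTower

end
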